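import Literature.Geometry.Lorentzian.KerrStarAngularSeparation
import Literature.Analysis.FunctionSpaces.L2ValuedPathDeriv
import HarnessLib

/-!
# Angular slices of functions on Kerr in the coordinates `(t*, r, θ, φ*)` as `L²(S²)`-valued
# maps: continuity and coordinate derivatives

Dafermos–Rodnianski–Shlapentokh-Rothman, arXiv:1402.7034, §5.1–5.2: Carter's separation treats a
function `Ψ(t, r, θ, φ)` on the Kerr exterior, at fixed `(t, r)`, as an element of `L²` of the
sphere, expands it in oblate spheroidal harmonics and Fourier transforms in `t`; the separated
equations are "interpreted in `L²_ω l²_{mℓ}`" for each `r` (§5.2.3). This file provides the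
first, purely kinematic layer of that dictionary for the tree's coordinate space `E4 ∋ q =
(t*, r, θ, φ*)` (`Kerr.starq`, `Kerr.starChart`) and the sphere space
`𝓚 = L²([-1, 1] × 𝕋)` of `OblateSpheroidalSphereBasis` (`x = cos θ`, `φ̄ = φ* mod 2π`):

* the `t*`- and `r`-coordinate lines (`starq_add_t`, `starq_add_r`) and line derivatives
  (`hasDerivAt_comp_starq_t`, `hasDerivAt_comp_starq_r`); the coordinate derivative
  `Kerr.dir i G = ∂_i G` of a function on coordinate space;
* `Kerr.coordSlice G t r (θ, φ) = G(starq t r θ φ)` and **the slice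
  `Kerr.angSlice G hG t r = 𝓛(coordSlice G t r) ∈ 𝓚`** (`𝓛 = polarLp (2π)`), with
  `Kerr.sliceFn a Φ = coordSlice (starPull a Φ)`;
* `norm_polarLp_le` (an `L²` bound from a uniform bound), `polarLp_sub'`;
* **continuity** of `(t, r) ↦ angSlice G t r` for continuous `G` (`continuous_angSlice`, uniform
  continuity on compacts);
* **coordinate derivatives in `𝓚`**: for `G ∈ C¹`, `r ↦ angSlice G t r` has derivative
  `angSlice (∂₁G) t r` and `t ↦ angSlice G t r` has derivative `angSlice (∂₀G) t r`
  (`hasDerivAt_angSlice_r`, `hasDerivAt_angSlice_t`; from the tree's `hasDerivAt_toLp`).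

## References

* M. Dafermos, I. Rodnianski, Y. Shlapentokh-Rothman, arXiv:1402.7034, Def. 5.1.1, §5.2.2–5.2.3.
  [DafermosRodnianskiShlapentokhrothman2014]
-/

noncomputable section

open Real Set Filter MeasureTheory Function
open scoped Topology ENNReal

namespace Literature.Geometry.Lorentzian

namespace Kerr

open Literature.Analysis.SpecialFunctions Literature.Analysis.FunctionSpaces

/-! ### The `t*`- and `r`-coordinate lines -/

/-- The `t*`-coordinate line. [folklore] -/
theorem starq_add_t (t r θ φ s : ℝ) :
    starq (t + s) r θ φ = starq t r θ φ + s • E4.basisVector 0 := by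
  ext i
  rw [add_smul_basisVector_apply]
  fin_cases i <;> simp [starq]

/-- The `r`-coordinate line. [folklore] -/
theorem starq_add_r (t r θ φ s : ℝ) :
    starq t (r + s) θ φ = starq t r θ φ + s • E4.basisVector 1 := by
  ext i
  rw [add_smul_basisVector_apply]
  fin_cases i <;> simp [starq]

/-- The `t*`-line has velocity `∂₀`. [folklore] -/
theorem hasDerivAt_starq_t (t r θ φ : ℝ) :
    HasDerivAt (fun t' : ℝ ↦ starq t' r θ φ) (E4.basisVector 0) t := by
  have h : (fun t' : ℝ ↦ starq t' r θ φ) = fun t' ↦ starq 0 r θ φ + t' • E4.basisVector 0 := by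
    funext t'
    rw [← starq_add_t, zero_add]
  rw [h]
  exact (((hasDerivAt_id t).smul_const (E4.basisVector 0)).const_add _).congr_deriv (one_smul _ _)

/-- The `r`-line has velocity `∂₁`. [folklore] -/
theorem hasDerivAt_starq_r (t r θ φ : ℝ) :
    HasDerivAt (fun r' : ℝ ↦ starq t r' θ φ) (E4.basisVector 1) r := by
  have h : (fun r' : ℝ ↦ starq t r' θ φ) = fun r' ↦ starq t 0 θ φ + r' • E4.basisVector 1 := by
    funext r'
    rw [← starq_add_r, zero_add]
  rw [h]
  exact (((hasDerivAt_id r).smul_const (E4.basisVector 1)).const_add _).congr_deriv (one_smul _ _)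

/-- `starq` is jointly continuous in its four arguments. [folklore] -/
theorem continuous_starq₄ : Continuous fun p : ℝ × ℝ × ℝ × ℝ ↦ starq p.1 p.2.1 p.2.2.1 p.2.2.2 := by
  have h : (fun p : ℝ × ℝ × ℝ × ℝ ↦ starq p.1 p.2.1 p.2.2.1 p.2.2.2) = fun p ↦
      starq 0 0 0 0 + p.1 • E4.basisVector 0 + p.2.1 • E4.basisVector 1 +
        p.2.2.1 • E4.basisVector 2 + p.2.2.2 • E4.basisVector 3 := by
    funext p
    rw [← starq_add_t, zero_add, ← starq_add_r, zero_add, ← starq_add_theta, zero_add,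
      ← starq_add_phi, zero_add]
  rw [h]
  fun_prop

section LineDerivatives

variable {G : E4 → ℝ}

/-- **Line derivative along `t*`**: `d/dt G(starq t r θ φ) = ∂₀G`. [folklore] -/
theorem hasDerivAt_comp_starq_t (t r θ φ : ℝ) (hG : DifferentiableAt ℝ G (starq t r θ φ)) :
    HasDerivAt (fun t' ↦ G (starq t' r θ φ)) (fderiv ℝ G (starq t r θ φ) (E4.basisVector 0)) t :=
  hG.hasFDerivAt.comp_hasDerivAt t (hasDerivAt_starq_t t r θ φ)

/-- **Line derivative along `r`**: `d/dr G(starq t r θ φ) = ∂₁G`. [folklore] -/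
theorem hasDerivAt_comp_starq_r (t r θ φ : ℝ) (hG : DifferentiableAt ℝ G (starq t r θ φ)) :
    HasDerivAt (fun r' ↦ G (starq t r' θ φ)) (fderiv ℝ G (starq t r θ φ) (E4.basisVector 1)) r :=
  hG.hasFDerivAt.comp_hasDerivAt r (hasDerivAt_starq_r t r θ φ)

end LineDerivatives

/-! ### Coordinate derivatives and slices -/

/-- **The coordinate derivative `∂_i G`** of a function on coordinate space. [folklore] -/
def dir (i : Fin 4) (G : E4 → ℝ) (q : E4) : ℝ := fderiv ℝ G q (E4.basisVector i)

/-- Unfolding. [folklore] -/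
theorem dir_apply (i : Fin 4) (G : E4 → ℝ) (q : E4) : dir i G q = fderiv ℝ G q (E4.basisVector i) :=
  rfl

/-- `∂_i` lowers the differentiability class by one. [folklore] -/
theorem contDiff_dir {n : ℕ∞} {G : E4 → ℝ} (hG : ContDiff ℝ (n + 1) G) (i : Fin 4) :
    ContDiff ℝ n (dir i G) := by
  unfold dir
  exact (hG.fderiv_right (m := n) le_rfl).clm_apply contDiff_const

/-- `∂_i G` is continuous for `G ∈ C¹`. [folklore] -/
theorem continuous_dir {n : WithTop ℕ∞} {G : E4 → ℝ} (hG : ContDiff ℝ n G) (hn : n ≠ 0)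
    (i : Fin 4) : Continuous (dir i G) := by
  unfold dir
  exact (ContinuousLinearMap.apply ℝ ℝ (E4.basisVector i)).continuous.comp (hG.continuous_fderiv hn)

/-- **The slice `(θ, φ) ↦ G(t, r, θ, φ)`** of a function on coordinate space, as a complex function.
[folklore] -/
def coordSlice (G : E4 → ℝ) (t r : ℝ) (θ φ : ℝ) : ℂ := (G (starq t r θ φ) : ℂ)

/-- Unfolding. [folklore] -/
theorem coordSlice_apply (G : E4 → ℝ) (t r θ φ : ℝ) :
    coordSlice G t r θ φ = (G (starq t r θ φ) : ℂ) := rfl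

/-- `sliceFn a Φ = coordSlice (Φ ∘ κ_a)`. [folklore] -/
theorem sliceFn_eq_coordSlice (a : ℝ) (Φ : E4 → ℝ) (t r : ℝ) :
    sliceFn a Φ t r = coordSlice (starPull a Φ) t r := rfl

/-- Joint continuity of `(t, r, θ, φ) ↦ coordSlice G t r θ φ`. [folklore] -/
theorem continuous_coordSlice₄ {G : E4 → ℝ} (hG : Continuous G) :
    Continuous fun p : ℝ × ℝ × ℝ × ℝ ↦ coordSlice G p.1 p.2.1 p.2.2.1 p.2.2.2 :=
  Complex.continuous_ofReal.comp (hG.comp continuous_starq₄)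

/-- Continuity of each slice. [folklore] -/
theorem continuous_coordSlice {G : E4 → ℝ} (hG : Continuous G) (t r : ℝ) :
    Continuous (uncurry (coordSlice G t r)) :=
  (continuous_coordSlice₄ hG).comp
    (continuous_const.prodMk (continuous_const.prodMk continuous_id))

/-! ### `L²` bounds for the polar pull-back -/

section Polar

variable (T : ℝ) [hT : Fact (0 < T)]

/-- The total mass of `sphereMeasure T` is `2`. [folklore] -/
theorem sphereMeasure_univ : sphereMeasure T univ = 2 := by
  rw [← univ_prod_univ, Measure.prod_prod, legendreMeasure_univ, measure_univ, mul_one]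

/-- **`L²` bound from a uniform bound**: `‖𝓛g‖ ≤ √2 · C` if `|g| ≤ C` on `[0, π] × [0, T]`.
[folklore] -/
theorem norm_polarLp_le {g : ℝ → ℝ → ℂ} (hg : Continuous (uncurry g)) {C : ℝ} (hC : 0 ≤ C)
    (hb : ∀ θ ∈ Icc 0 π, ∀ φ ∈ Icc 0 T, ‖g θ φ‖ ≤ C) :
    ‖polarLp T g hg‖ ≤ Real.sqrt 2 * C := by
  have hpt : ∀ z, ‖polarFn T g z‖ ≤ C := fun z ↦ by
    have hmem := (AddCircle.equivIco T 0 z.2).2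
    exact hb _ ⟨arccos_nonneg _, arccos_le_pi _⟩ _ ⟨hmem.1, by linarith [hmem.2]⟩
  have h1 : eLpNorm (polarFn T g) 2 (sphereMeasure T) ≤
      (sphereMeasure T) univ ^ (2 : ℝ≥0∞).toReal⁻¹ * ENNReal.ofReal C :=
    eLpNorm_le_of_ae_bound (ae_of_all _ hpt)
  rw [sphereMeasure_univ, ENNReal.toReal_ofNat] at h1
  rw [polarLp, Lp.norm_toLp]
  have h2 : ((2 : ℝ≥0∞) ^ (2 : ℝ)⁻¹ * ENNReal.ofReal C).toReal = Real.sqrt 2 * C := by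
    rw [ENNReal.toReal_mul, ENNReal.toReal_ofReal hC, ← ENNReal.toReal_rpow, ENNReal.toReal_ofNat,
      Real.sqrt_eq_rpow, one_div]
  rw [← h2]
  exact ENNReal.toReal_mono (ENNReal.mul_ne_top (ENNReal.rpow_ne_top_of_nonneg (by positivity)
    ENNReal.ofNat_ne_top) ENNReal.ofReal_ne_top) h1

/-- `𝓛` is additive: `𝓛g - 𝓛g' = 𝓛(g - g')`. [folklore] -/
theorem polarLp_sub' (g g' : ℝ → ℝ → ℂ) (hg : Continuous (uncurry g))
    (hg' : Continuous (uncurry g')) (hs : Continuous (uncurry fun θ φ ↦ g θ φ - g' θ φ)) :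
    polarLp T g hg - polarLp T g' hg' = polarLp T (fun θ φ ↦ g θ φ - g' θ φ) hs := by
  refine Lp.ext ?_
  filter_upwards [Lp.coeFn_sub (polarLp T g hg) (polarLp T g' hg'), coeFn_polarLp T g hg,
    coeFn_polarLp T g' hg', coeFn_polarLp T _ hs] with z h1 h2 h3 h4
  rw [h1, Pi.sub_apply, h2, h3, h4]
  rfl

end Polar

/-! ### The slice in `𝓚 = L²([-1,1] × 𝕋)`: continuity and coordinate derivatives -/

section AngSlice

variable [h2π : Fact (0 < 2 * π)]

/-- **The angular slice at `(t*, r)` as an element of `𝓚 = L²([-1, 1] × 𝕋)`.** [folklore] -/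
def angSlice (G : E4 → ℝ) (hG : Continuous G) (t r : ℝ) : Lp ℂ 2 (sphereMeasure (2 * π)) :=
  polarLp (2 * π) (coordSlice G t r) (continuous_coordSlice hG t r)

/-- Unfolding. [folklore] -/
theorem angSlice_def (G : E4 → ℝ) (hG : Continuous G) (t r : ℝ) :
    angSlice G hG t r = polarLp (2 * π) (coordSlice G t r) (continuous_coordSlice hG t r) := rfl

/-- **Continuity of `(t, r) ↦ angSlice G t r`** for continuous `G` (uniform continuity on compact
sets). [folklore] -/
theorem continuous_angSlice (G : E4 → ℝ) (hG : Continuous G) :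
    Continuous fun p : ℝ × ℝ ↦ angSlice G hG p.1 p.2 := by
  refine continuous_iff_continuousAt.2 fun p₀ ↦ ?_
  rw [Metric.continuousAt_iff]
  intro ε hε
  -- uniform continuity of `(t, r, θ, φ) ↦ G(starq t r θ φ)` on a compact box
  set K : Set (ℝ × ℝ × ℝ × ℝ) :=
    (Icc (p₀.1 - 1) (p₀.1 + 1) ×ˢ Icc (p₀.2 - 1) (p₀.2 + 1)) ×ˢ (Icc 0 π ×ˢ Icc 0 (2 * π))
      |>.image (fun w : (ℝ × ℝ) × ℝ × ℝ ↦ (w.1.1, w.1.2, w.2.1, w.2.2)) with hK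
  have hKc : IsCompact K := ((isCompact_Icc.prod isCompact_Icc).prod
    (isCompact_Icc.prod isCompact_Icc)).image (by fun_prop)
  have hU := hKc.uniformContinuousOn_of_continuous (continuous_coordSlice₄ hG).continuousOn
  rw [Metric.uniformContinuousOn_iff] at hU
  have hε' : 0 < ε / 2 := half_pos hε
  obtain ⟨δ, hδ, hUδ⟩ := hU (ε / 2) hε'
  refine ⟨min δ 1, lt_min hδ one_pos, fun p hp ↦ ?_⟩
  have hpδ : dist p p₀ < δ := lt_of_lt_of_le hp (min_le_left _ _)
  have hp1 : dist p p₀ < 1 := lt_of_lt_of_le hp (min_le_right _ _)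
  have hpt : |p.1 - p₀.1| < 1 := by
    have h := le_max_left (dist p.1 p₀.1) (dist p.2 p₀.2)
    rw [← Prod.dist_eq, Real.dist_eq] at h
    exact lt_of_le_of_lt h hp1
  have hpr : |p.2 - p₀.2| < 1 := by
    have h := le_max_right (dist p.1 p₀.1) (dist p.2 p₀.2)
    rw [← Prod.dist_eq, Real.dist_eq] at h
    exact lt_of_le_of_lt h hp1
  -- pointwise bound on the difference of the slices
  have hb : ∀ θ ∈ Icc 0 π, ∀ φ ∈ Icc 0 (2 * π),
      ‖coordSlice G p.1 p.2 θ φ - coordSlice G p₀.1 p₀.2 θ φ‖ ≤ ε / 2 := by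
    intro θ hθ φ hφ
    have hmem : (p.1, p.2, θ, φ) ∈ K := by
      refine ⟨((p.1, p.2), θ, φ), ⟨⟨?_, ?_⟩, hθ, hφ⟩, rfl⟩
      · exact ⟨by linarith [(abs_lt.1 hpt).1], by linarith [(abs_lt.1 hpt).2]⟩
      · exact ⟨by linarith [(abs_lt.1 hpr).1], by linarith [(abs_lt.1 hpr).2]⟩
    have hmem₀ : (p₀.1, p₀.2, θ, φ) ∈ K :=
      ⟨((p₀.1, p₀.2), θ, φ),
        ⟨⟨⟨by linarith, by linarith⟩, ⟨by linarith, by linarith⟩⟩, hθ, hφ⟩, rfl⟩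
    have hdist : dist (p.1, p.2, θ, φ) (p₀.1, p₀.2, θ, φ) < δ := by
      have : dist (p.1, p.2, θ, φ) (p₀.1, p₀.2, θ, φ) = dist p p₀ := by
        simp only [Prod.dist_eq, dist_self, max_eq_left (dist_nonneg)]
      rw [this]
      exact hpδ
    have := hUδ _ hmem _ hmem₀ hdist
    rw [dist_eq_norm] at this
    exact this.le
  have hs : Continuous (uncurry fun θ φ ↦ coordSlice G p.1 p.2 θ φ - coordSlice G p₀.1 p₀.2 θ φ) :=
    (continuous_coordSlice hG p.1 p.2).sub (continuous_coordSlice hG p₀.1 p₀.2)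
  rw [dist_eq_norm, angSlice_def, angSlice_def, polarLp_sub' (2 * π) _ _ _ _ hs]
  calc ‖polarLp (2 * π) _ hs‖ ≤ Real.sqrt 2 * (ε / 2) := norm_polarLp_le (2 * π) hs hε'.le hb
    _ < ε := by
        have h2 : Real.sqrt 2 < 2 := by
          rw [show (2 : ℝ) = Real.sqrt 4 by
            rw [show (4 : ℝ) = 2 ^ 2 by norm_num, Real.sqrt_sq (by norm_num)]]
          exact Real.sqrt_lt_sqrt (by norm_num) (by norm_num)
        nlinarith

/-- The representative `polarFn` of a slice, evaluated. [folklore] -/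
theorem polarFn_coordSlice (G : E4 → ℝ) (t r : ℝ) (z : ℝ × AddCircle (2 * π)) :
    polarFn (2 * π) (coordSlice G t r) z =
      (G (starq t r (arccos z.1) ((AddCircle.equivIco (2 * π) 0 z.2 : ℝ))) : ℂ) := rfl

/-- Joint measurability of `(s, z) ↦ polarFn (coordSlice G (γ s)) z` along a continuous curve
`γ` in the `(t, r)`-plane. [folklore] -/
theorem stronglyMeasurable_polarFn_coordSlice {G : E4 → ℝ} (hG : Continuous G)
    {γt γr : ℝ → ℝ} (hγt : Continuous γt) (hγr : Continuous γr) :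
    StronglyMeasurable (uncurry fun s (z : ℝ × AddCircle (2 * π)) ↦
      polarFn (2 * π) (coordSlice G (γt s) (γr s)) z) := by
  have hm : Measurable fun p : ℝ × (ℝ × AddCircle (2 * π)) ↦
      (γt p.1, γr p.1, arccos p.2.1, ((AddCircle.equivIco (2 * π) 0 p.2.2 : ℝ))) :=
    (hγt.measurable.comp measurable_fst).prodMk ((hγr.measurable.comp measurable_fst).prodMk
      ((continuous_arccos.measurable.comp (measurable_fst.comp measurable_snd)).prodMk
        (measurable_subtype_coe.comp ((AddCircle.measurableEquivIco (2 * π) 0).measurable.comp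
          (measurable_snd.comp measurable_snd)))))
  exact ((continuous_coordSlice₄ hG).measurable.comp hm).stronglyMeasurable

/-- **`r`-derivative of the slice in `𝓚`**: for `G ∈ C¹`, `r ↦ angSlice G t r` has derivative
`angSlice (∂₁G) t r`. [folklore] -/
theorem hasDerivAt_angSlice_r {G : E4 → ℝ} (hG : ContDiff ℝ 1 G) (t r : ℝ) :
    HasDerivAt (fun r' ↦ angSlice G hG.continuous t r')
      (angSlice (dir 1 G) (continuous_dir hG one_ne_zero 1) t r) r := by
  have hd : ∀ (z : ℝ × AddCircle (2 * π)) (r' : ℝ),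
      HasDerivAt (fun r'' ↦ polarFn (2 * π) (coordSlice G t r'') z)
        (polarFn (2 * π) (coordSlice (dir 1 G) t r') z) r' := fun z r' ↦ by
    simp only [polarFn_coordSlice]
    exact (hasDerivAt_comp_starq_r t r' _ _ (hG.differentiable one_ne_zero _)).ofReal_comp
  exact hasDerivAt_toLp (μ := sphereMeasure (2 * π)) r hd
    (stronglyMeasurable_polarFn_coordSlice (continuous_dir hG one_ne_zero 1) continuous_const
      continuous_id)
    (fun r' ↦ memLp_polarFn (2 * π) (continuous_coordSlice hG.continuous t r'))
    (fun r' ↦ memLp_polarFn (2 * π) (continuous_coordSlice (continuous_dir hG one_ne_zero 1) t r'))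
    (((continuous_angSlice (dir 1 G) (continuous_dir hG one_ne_zero 1)).comp
      (continuous_const.prodMk continuous_id)).continuousAt)

/-- **`t*`-derivative of the slice in `𝓚`**: for `G ∈ C¹`, `t ↦ angSlice G t r` has derivative
`angSlice (∂₀G) t r`. [folklore] -/
theorem hasDerivAt_angSlice_t {G : E4 → ℝ} (hG : ContDiff ℝ 1 G) (t r : ℝ) :
    HasDerivAt (fun t' ↦ angSlice G hG.continuous t' r)
      (angSlice (dir 0 G) (continuous_dir hG one_ne_zero 0) t r) t := by
  have hd : ∀ (z : ℝ × AddCircle (2 * π)) (t' : ℝ),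
      HasDerivAt (fun t'' ↦ polarFn (2 * π) (coordSlice G t'' r) z)
        (polarFn (2 * π) (coordSlice (dir 0 G) t' r) z) t' := fun z t' ↦ by
    simp only [polarFn_coordSlice]
    exact (hasDerivAt_comp_starq_t t' r _ _ (hG.differentiable one_ne_zero _)).ofReal_comp
  exact hasDerivAt_toLp (μ := sphereMeasure (2 * π)) t hd
    (stronglyMeasurable_polarFn_coordSlice (continuous_dir hG one_ne_zero 0) continuous_id
      continuous_const)
    (fun t' ↦ memLp_polarFn (2 * π) (continuous_coordSlice hG.continuous t' r))
    (fun t' ↦ memLp_polarFn (2 * π) (continuous_coordSlice (continuous_dir hG one_ne_zero 0) t' r))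
    (((continuous_angSlice (dir 0 G) (continuous_dir hG one_ne_zero 0)).comp
      (continuous_id.prodMk continuous_const)).continuousAt)

end AngSlice

end Kerr

end Literature.Geometry.Lorentzian
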